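import Literature.MathematicalPhysics.QuantumFieldTheory.Balaban1983to89.T3PrintedMinimiserExistence
import Literature.MathematicalPhysics.QuantumFieldTheory.Balaban1983to89.T3DescentFibreTower
import Literature.MathematicalPhysics.QuantumFieldTheory.Balaban1983to89.T3InteriorExcision
import HarnessLib

/-!
# S2β · THE CUT-OFF-HEIGHT LAYER `K = J` OF GAP♯∘ `UniformFibreGapOrbit` (registry stub 2) IS FREE — POINTWISE, NO THRESHOLD
# (FILE 3 of the TABLE-DIAGONAL set; FILE 1 ✓`…S2BetaTableDiagonal` = S2β, FILE 2 ✓`…S2BetaTableDiagonalCan` = stubs 4∕5 + 1L4ᶜ∘'s diagonal (R)(P)(T) lemmas)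

Cell `ym3-torus` (HUMAN RULING D-0037: rung R3 = continuum `SU(2)` Yang–Mills on `T³` — NOT `d = 4`, NOT infinite volume, NOT a mass gap, NOT the Clay
problem); width seat `ym-ust-20520-w5` (gen 19); helper of the crux `stmt-QuantumFields-20520` `UnitScaleTilt.FluctuationComparisonRegPrIntL`
(`--supports … --as helper`, NOT a proof of it).  THEOREMS ONLY: 0 `def`, 0 `instance`, 0 `notation`, 0 `sorry`, default heartbeats; literature imports only.

★★★ `uniformFibreGapOrbit_of_offDiagonal` — registry stub 2 GAP♯∘ `UniformFibreGapOrbit` (`Cruxes/FluctuationComparisonRegPrIntL/Lines/semiclassical_s2beta.lean` v11.4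
3732b7df :768; the Lines-local `argminHist` :725 ∕ `ResidualGauge` :746 δ-UNFOLDED to set-builder ∕ subtype EXACTLY as in w4-20520 g19's ✓`…WindowExactnessOfGapOrbitThm1`
binder `hGap`, ws-sha16 6fbe07744af083d3 — so this door and the EXW-DOOR read ONE text) from its off-diagonal edition (`(hJK : J ≤ K)` ↦ `(hJK : J < K)`, `hJK.le`
inside), with ALL letters `c₀ pS ε₁ γ₁ μ` UNCHANGED.  The diagonal layer (★`gapOrbit_self`) is POINTWISE free — no coupling threshold, no window: at `K = J` the fibre
is `{V}` (✓`fibre_self`), so `U = V = U₀` for every minimising history `U₀` and every fibre point `U`; the excess action `A(U) − minActionRegPr` is `0` by `U₀`'s own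
defining equation, and the residual-orbit infimum is `≤` its value at `w ≡ 1` (`U₀¹ = U₀`, `V·V⁻¹ = 1`, `dist1 1 = 0`), i.e. `≤ 0`, while `μ·L⁰ ≥ 0`.

NET (registry granularity, CREDITS NOTHING): with FILEs 1–2, the `K = J` layer of S2β and of the registered ∘-rows {GAP♯∘, H4ᶜ∘, LFR♯ᶜ∘} (+ 1L4ᶜ∘'s (R)(P)(T)) is a tree
theorem; EXW∘'s corner is w4 g19's ✓`exists_regMin_histGood_self`; DET-REP-B‴∘'s diagonal is not examined (its `TubeRows` Haar-chart identity is not a pointwise matter).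
A CONSISTENCY rung at the cut-off height, NOT a piece of the stiffness analysis.  HONEST SCOPE: a triviality of the one-point fibre; nothing of GAP♯∘'s `J < K` content
([Balaban1985Variational] (142): the Hessian gap transverse to the residual orbit, propagated along the fibre), of EXW∘ ∕ DET-REP-B‴∘, of S2β, of the crux 20520 is
proved or claimed; registry 20520 v11.4 0∕5 UNCHANGED; `YM3TorusSU2` NOT proved; the Yang–Mills mass gap (Clay) NOT proved.

References: [Balaban1985Variational] T. Bałaban, CMP 102 (1985) Thm 1 (8)–(10) p.279, (142) p.299; [Balaban1984PropagatorsII] CMP 96 (1984) (1.33);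
[Balaban1985Averaging] CMP 98 (1985) (8) p.19 (gauge covariance of the averaging).
-/

set_option autoImplicit false

noncomputable section

open Filter Topology Set
open Literature.MathematicalPhysics.QuantumFieldTheory.Balaban1983to89
open Literature.MathematicalPhysics.QuantumFieldTheory.Balaban1983to89.T3ContinuumYM3Torus
open Literature.MathematicalPhysics.QuantumFieldTheory.Balaban1983to89.T3NestedUnitLaws
open Literature.MathematicalPhysics.QuantumFieldTheory.Balaban1983to89.T3UnitLawDensityEML
open Literature.MathematicalPhysics.QuantumFieldTheory.Balaban1983to89.T3TiltDescent
open Literature.MathematicalPhysics.QuantumFieldTheory.Balaban1983to89.T3UnitScaleTilt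
open Literature.MathematicalPhysics.QuantumFieldTheory.Balaban1983to89.T3PrintedRegularMinimiser
open Literature.MathematicalPhysics.QuantumFieldTheory.Balaban1983to89.T3ConstrainedMinimiser (fibre)
open Literature.MathematicalPhysics.QuantumFieldTheory.Balaban1983to89.T3LevelShift
open Literature.MathematicalPhysics.QuantumFieldTheory.Balaban1983to89.Missing
open Literature.MathematicalPhysics.QuantumFieldTheory.Balaban1983to89.T4Continuum

namespace Summit.QuantumFields.YangMills.Theorems.FluctuationComparisonRegPrIntLS2BetaTableDiagonalOrgans

/-! ## GAP♯∘ on the diagonal: pointwise, no threshold; the door -/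

section Gap

variable (F : T3Family)

/-- `w ≡ 1` acts trivially: `U^1 = U`. [cite: Balaban1985Averaging, (8) p.19] -/
theorem gaugeAct_one (K : ℕ) (U : GaugeField (F.P K) 0 (Matrix.specialUnitaryGroup (Fin 2) ℂ)) :
    GaugeField.gaugeAct (fun _ : Site (F.P K) 0 => (1 : Matrix.specialUnitaryGroup (Fin 2) ℂ)) U = U := by
  funext b
  simp [GaugeField.gaugeAct]

/-- ★ **THE GAP♯∘ INEQUALITY ON THE DIAGONAL, POINTWISE** (`K = J`, any `μ`, any datum, no threshold): for `U₀` in the minimising set over `V` and `U` in the fibre of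
`V` at depth `0`, `μ·L⁰·⨅_w Σ dist1(U·(U₀^w)⁻¹)² ≤ A(U) − minActionRegPr` — both sides are `0` (`U = V = U₀` by ✓`fibre_self`; the infimum is attained `≤` at `w ≡ 1`).
[cite: Balaban1985Variational, Thm 1 (8) p.279 and (142) p.299] -/
theorem gapOrbit_self {γ b₀ p₀ ε₀ μ : ℝ} (hμ : 0 < μ) {K : ℕ} (hKK : K ≤ K)
    {V U₀ U : GaugeField (F.P K) 0 (Matrix.specialUnitaryGroup (Fin 2) ℂ)}
    (hU₀ : U₀ ∈ {U' | U' ∈ fibre F ℰp K K hKK V ∧ U' ∈ histGood F ℰp (θBal F.L γ b₀ p₀) K K ∧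
      wilsonAction4 U' = minActionRegPr F K K hKK ε₀ V})
    (hU : U ∈ fibre F ℰp K K hKK V) :
    μ * ((F.L : ℝ)⁻¹) ^ (2 * (K - K)) *
        (⨅ w : {w : Site (F.P K) 0 → Matrix.specialUnitaryGroup (Fin 2) ℂ |
            ∀ U : GaugeField (F.P K) 0 (Matrix.specialUnitaryGroup (Fin 2) ℂ),
              descendTo F ℰp K K hKK (GaugeField.gaugeAct w U) = descendTo F ℰp K K hKK U},
          ∑ ℓ : PBond (F.P K) 0,
            dist1 (U ℓ * ((GaugeField.gaugeAct (w : Site (F.P K) 0 → Matrix.specialUnitaryGroup (Fin 2) ℂ) U₀) ℓ)⁻¹) ^ 2)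
      ≤ wilsonAction4 U - minActionRegPr F K K hKK ε₀ V := by
  have hfib : fibre F ℰp K K hKK V = {V} := T3DescentFibreTower.fibre_self F ℰp K V
  have hUV : U = V := by simpa [hfib] using hU
  have hU₀V : U₀ = V := by simpa [hfib] using hU₀.1
  have hA : wilsonAction4 U₀ = minActionRegPr F K K hKK ε₀ V := hU₀.2.2
  -- the residual transformation `w ≡ 1`
  have h1 : (fun _ : Site (F.P K) 0 => (1 : Matrix.specialUnitaryGroup (Fin 2) ℂ)) ∈
      {w : Site (F.P K) 0 → Matrix.specialUnitaryGroup (Fin 2) ℂ |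
        ∀ U : GaugeField (F.P K) 0 (Matrix.specialUnitaryGroup (Fin 2) ℂ),
          descendTo F ℰp K K hKK (GaugeField.gaugeAct w U) = descendTo F ℰp K K hKK U} := by
    intro U'
    rw [gaugeAct_one]
  have hinf : (⨅ w : {w : Site (F.P K) 0 → Matrix.specialUnitaryGroup (Fin 2) ℂ |
            ∀ U : GaugeField (F.P K) 0 (Matrix.specialUnitaryGroup (Fin 2) ℂ),
              descendTo F ℰp K K hKK (GaugeField.gaugeAct w U) = descendTo F ℰp K K hKK U},
          ∑ ℓ : PBond (F.P K) 0,
            dist1 (U ℓ * ((GaugeField.gaugeAct (w : Site (F.P K) 0 → Matrix.specialUnitaryGroup (Fin 2) ℂ) U₀) ℓ)⁻¹) ^ 2) ≤ 0 := by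
    refine (ciInf_le ⟨0, ?_⟩ ⟨_, h1⟩).trans_eq ?_
    · rintro _ ⟨w, rfl⟩
      exact Finset.sum_nonneg fun ℓ _ => pow_nonneg (GaugeGroup.dist1_nonneg _) 2
    · show ∑ ℓ : PBond (F.P K) 0, dist1 (U ℓ * ((GaugeField.gaugeAct (fun _ : Site (F.P K) 0 => (1 : Matrix.specialUnitaryGroup (Fin 2) ℂ)) U₀) ℓ)⁻¹) ^ 2 = 0
      rw [gaugeAct_one, hU₀V, hUV]
      simp [GaugeGroup.dist1_one]
  have hL0 : 0 ≤ ((F.L : ℝ)⁻¹) ^ (2 * (K - K)) := pow_nonneg (inv_nonneg.mpr (Nat.cast_nonneg _)) _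
  have hlhs : μ * ((F.L : ℝ)⁻¹) ^ (2 * (K - K)) *
        (⨅ w : {w : Site (F.P K) 0 → Matrix.specialUnitaryGroup (Fin 2) ℂ |
            ∀ U : GaugeField (F.P K) 0 (Matrix.specialUnitaryGroup (Fin 2) ℂ),
              descendTo F ℰp K K hKK (GaugeField.gaugeAct w U) = descendTo F ℰp K K hKK U},
          ∑ ℓ : PBond (F.P K) 0,
            dist1 (U ℓ * ((GaugeField.gaugeAct (w : Site (F.P K) 0 → Matrix.specialUnitaryGroup (Fin 2) ℂ) U₀) ℓ)⁻¹) ^ 2) ≤ 0 :=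
    mul_nonpos_of_nonneg_of_nonpos (mul_nonneg hμ.le hL0) hinf
  have hrhs : 0 ≤ wilsonAction4 U - minActionRegPr F K K hKK ε₀ V := by
    rw [hUV, ← hA, hU₀V]; simp
  exact hlhs.trans hrhs

/-- ★★★ **GAP♯∘ `UniformFibreGapOrbit` (registry v11.4 :768 = the type of `stub_uniformFibreGapOrbit`, `argminHist`∕`ResidualGauge` δ-unfolded as in ✓p770212's `hGap`)
FROM ITS OFF-DIAGONAL EDITION** (`(hJK : J ≤ K)` ↦ `(hJK : J < K)`, `hJK.le` inside): ALL thresholds unchanged (`c₀ pS ε₁ γ₁ μ`); the diagonal is `gapOrbit_self`.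
[cite: Balaban1985Variational, Thm 1 (8)-(10) p.279 and (142) p.299; Balaban1984PropagatorsII, (1.33)] -/
theorem uniformFibreGapOrbit_of_offDiagonal
    (h : ∀ (L : ℕ), ∃ c₀ : ℝ, 0 < c₀ ∧ c₀ ≤ 1 ∧ ∀ (cw : ℝ), 0 < cw → cw ≤ c₀ → ∃ pS : ℝ, ∀ (b₀ p₀ : ℝ), 0 < b₀ → pS ≤ p₀ → 0 < p₀ →
      ∃ ε₁ : ℝ, 0 < ε₁ ∧ ∀ (ε₀ : ℝ), 0 < ε₀ → ε₀ ≤ ε₁ →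
      ∃ γ₁ : ℝ, 0 < γ₁ ∧ ∃ μ : ℝ, 0 < μ ∧ ∀ (F : T3Family) (γ : ℝ), F.L = L → 0 < γ → γ ≤ γ₁ →
        ∀ (J K : ℕ) (hJK : J < K) (V : GaugeField (F.P J) 0 (Matrix.specialUnitaryGroup (Fin 2) ℂ)), PlaqSmall (θBal F.L γ (cw * b₀) p₀ J) V →
          ∀ U₀ ∈ {U' | U' ∈ fibre F ℰp J K hJK.le V ∧ U' ∈ histGood F ℰp (θBal F.L γ b₀ p₀) K J ∧
              wilsonAction4 U' = minActionRegPr F J K hJK.le ε₀ V},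
            ∀ U ∈ fibre F ℰp J K hJK.le V, U ∈ histGood F ℰp (θBal F.L γ b₀ p₀) K J →
              μ * ((F.L : ℝ)⁻¹) ^ (2 * (K - J)) *
                  (⨅ w : {w : Site (F.P K) 0 → Matrix.specialUnitaryGroup (Fin 2) ℂ |
                      ∀ U : GaugeField (F.P K) 0 (Matrix.specialUnitaryGroup (Fin 2) ℂ),
                        descendTo F ℰp J K hJK.le (GaugeField.gaugeAct w U) = descendTo F ℰp J K hJK.le U},
                    ∑ ℓ : PBond (F.P K) 0,
                      dist1 (U ℓ * ((GaugeField.gaugeAct (w : Site (F.P K) 0 → Matrix.specialUnitaryGroup (Fin 2) ℂ) U₀) ℓ)⁻¹) ^ 2)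
                ≤ wilsonAction4 U - minActionRegPr F J K hJK.le ε₀ V) :
    ∀ (L : ℕ), ∃ c₀ : ℝ, 0 < c₀ ∧ c₀ ≤ 1 ∧ ∀ (cw : ℝ), 0 < cw → cw ≤ c₀ → ∃ pS : ℝ, ∀ (b₀ p₀ : ℝ), 0 < b₀ → pS ≤ p₀ → 0 < p₀ →
      ∃ ε₁ : ℝ, 0 < ε₁ ∧ ∀ (ε₀ : ℝ), 0 < ε₀ → ε₀ ≤ ε₁ →
      ∃ γ₁ : ℝ, 0 < γ₁ ∧ ∃ μ : ℝ, 0 < μ ∧ ∀ (F : T3Family) (γ : ℝ), F.L = L → 0 < γ → γ ≤ γ₁ →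
        ∀ (J K : ℕ) (hJK : J ≤ K) (V : GaugeField (F.P J) 0 (Matrix.specialUnitaryGroup (Fin 2) ℂ)), PlaqSmall (θBal F.L γ (cw * b₀) p₀ J) V →
          ∀ U₀ ∈ {U' | U' ∈ fibre F ℰp J K hJK V ∧ U' ∈ histGood F ℰp (θBal F.L γ b₀ p₀) K J ∧
              wilsonAction4 U' = minActionRegPr F J K hJK ε₀ V},
            ∀ U ∈ fibre F ℰp J K hJK V, U ∈ histGood F ℰp (θBal F.L γ b₀ p₀) K J →
              μ * ((F.L : ℝ)⁻¹) ^ (2 * (K - J)) *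
                  (⨅ w : {w : Site (F.P K) 0 → Matrix.specialUnitaryGroup (Fin 2) ℂ |
                      ∀ U : GaugeField (F.P K) 0 (Matrix.specialUnitaryGroup (Fin 2) ℂ),
                        descendTo F ℰp J K hJK (GaugeField.gaugeAct w U) = descendTo F ℰp J K hJK U},
                    ∑ ℓ : PBond (F.P K) 0,
                      dist1 (U ℓ * ((GaugeField.gaugeAct (w : Site (F.P K) 0 → Matrix.specialUnitaryGroup (Fin 2) ℂ) U₀) ℓ)⁻¹) ^ 2)
                ≤ wilsonAction4 U - minActionRegPr F J K hJK ε₀ V := by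
  intro L
  obtain ⟨c₀, hc₀, hc₀1, H⟩ := h L
  refine ⟨c₀, hc₀, hc₀1, fun cw hcw hcwle => ?_⟩
  obtain ⟨pS, H⟩ := H cw hcw hcwle
  refine ⟨pS, fun b₀ p₀ hb hpS hp => ?_⟩
  obtain ⟨ε₁, hε₁, H⟩ := H b₀ p₀ hb hpS hp
  refine ⟨ε₁, hε₁, fun ε₀ hε₀ hε₀1 => ?_⟩
  obtain ⟨γ₁, hγ₁, μ, hμ, H⟩ := H ε₀ hε₀ hε₀1
  refine ⟨γ₁, hγ₁, μ, hμ, fun F γ hFL hγ hγle J K hJK V hV U₀ hU₀ U hU hUh => ?_⟩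
  rcases eq_or_lt_of_le hJK with hJKeq | hJKlt
  · subst hJKeq
    exact gapOrbit_self F hμ hJK hU₀ hU
  · exact H F γ hFL hγ hγle J K hJKlt V hV U₀ hU₀ U hU hUh

end Gap


end Summit.QuantumFields.YangMills.Theorems.FluctuationComparisonRegPrIntLS2BetaTableDiagonalOrgans

end
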